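import Summits.AnomalousDissipation.AnomalousDissipation.Theorems.SolenoidalFractalHomogenisationLagrangianStepD1TailKernelDefs
import Summits.AnomalousDissipation.AnomalousDissipation.Theorems.SolenoidalFractalHomogenisationLagrangianStepD1TailCert
import Summits.AnomalousDissipation.AnomalousDissipation.Theorems.SolenoidalFractalHomogenisationLagrangianStepSidebandStateBound
import Summits.AnomalousDissipation.AnomalousDissipation.Theorems.SolenoidalFractalHomogenisationLagrangianStepSidebandDiagIdentity
import HarnessLib

/-!
# K1L_D `stub_D1_residueTail` (registry v17, stmt-AnomalousDissipation-27980) — lane A4 `hbound`, CORE: the slot-pair kernel as a pairing, the cubature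
# response setting, and the ν-free arithmetic of lane A's table `gTail` (helper; `--supports stmt-AnomalousDissipation-27980`)

Summits-side helper file of route `SolenoidalFractalHomogenisation` (prover seat `ad-sawtooth-k1loc-p1` g13, lane A owner; per-pair bounds `hbound` of
`D1TailCert.relSmall_tail_of_table`, memo `Lines/onelevel-D1-tail-cert.md` §2–§3).  Everything proved; no definitions, no named facts, no sorry.
Writing `pC = (p : ℂ³)`, `qC = (q : ℂ³)` for real test vectors read in `ℂ³`:
* `re_inner_apply_realVec`, `re_inner_cmat_realVec` — `Σ_{i,l} pᵢ q_l Re((M e_l)ᵢ) = Re⟪pC, M qC⟫` (`M` real-linear) and `Σ_{i,l} pᵢ q_l A_{il} = Re⟪pC, cmat(A) qC⟫`;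
* **`tailKernel_eq_re_inner`** — `tailKernel ν S p q j j' = (ν/4π²)·Re⟪pC, M_{jj'} qC⟫ − Re⟪pC, cmat(freshMat S j j') qC⟫` (`ν > 0`);
* `norm_transversalProj_realVec` — `‖P_{mⱼ} pC‖ = √(PpSq j p)`;
* `mem_box_cubature`, `neg_mem_box_cubature` — `±mⱼ ∈ box (R0 ν)` for `0 < ν ≤ 1` (entries of `mⱼ` in `{0, ±1}`);
* **`tail_arith`** — the ν-free bookkeeping: `(ν/4π²)·(1/P₁)·((1/(2|mⱼ|))·A·(2·(e^{−θmin}·(8π‖α_{j'}‖/r·B)))·L¹ⱼ) = gTail j j'·(A·B)`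
  (`P₁ = 3720·MB/ν`, `L¹ⱼ = MBτⱼ/ν`, `r = 4π²ν(10/11)`, `8π‖α_{j'}‖ = 2/|m_{j'}|`; `D1TailCert.prefactor_eq`).
NOT a proof of the registered stub, of the crux, or of anomalous dissipation; rung leaf F-D1 infrastructure.
-/

set_option linter.dupNamespace false

noncomputable section

namespace Summit.AnomalousDissipation.AnomalousDissipation.Theorems.SolenoidalFractalHomogenisation.LagrangianStep.D1Tail

open Summit.AnomalousDissipation.AnomalousDissipation.Theorems
open Summit.AnomalousDissipation.AnomalousDissipation.Theorems.SolenoidalFractalHomogenisation.LagrangianStep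
open Summit.AnomalousDissipation.AnomalousDissipation.Theorems.SolenoidalFractalHomogenisation.LagrangianStep.WCrossing
open Summit.AnomalousDissipation.AnomalousDissipation.Theorems.SolenoidalFractalHomogenisation.LagrangianStep.D1ResidueCert
open Summit.AnomalousDissipation.AnomalousDissipation.Theorems.SolenoidalFractalHomogenisation.LagrangianStep.D1TailCert
open Summit.AnomalousDissipation.AnomalousDissipation.Theorems.SolenoidalFractalHomogenisation.LagrangianStep.Sideband
open Literature.Analysis Literature.Analysis.FluidPDE Literature.Analysis.FunctionSpaces Literature.Analysis.FunctionSpaces.Torus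
open Literature.Analysis.FluidPDE.Torus Literature.Analysis.FluidPDE.LatticeShear
open Set Real Complex
open scoped InnerProductSpace

/-! ## §1 The slot-pair kernel as a pairing in `ℂ³` -/

/-- A real vector read in `ℂ³` is its coordinate expansion with REAL coefficients. [folklore] -/
theorem realVec_eq_sum (q : Fin 3 → ℝ) :
    (WithLp.toLp 2 fun i => ((q i : ℝ) : ℂ) : EuclideanSpace ℂ (Fin 3)) = ∑ l, (q l : ℝ) • EuclideanSpace.single l (1:ℂ) := by
  have h := (EuclideanSpace.basisFun (Fin 3) ℂ).sum_repr (WithLp.toLp 2 fun i => ((q i : ℝ) : ℂ))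
  rw [← h]
  refine Finset.sum_congr rfl fun l _ => ?_
  rw [EuclideanSpace.basisFun_repr, EuclideanSpace.basisFun_apply, PiLp.toLp_apply, Complex.coe_smul]

/-- `Σ_{i,l} pᵢ q_l Re((M e_l)ᵢ) = Re⟪pC, M qC⟫` for a real-linear `M` on `ℂ³`. [folklore] -/
theorem re_inner_apply_realVec (M : EuclideanSpace ℂ (Fin 3) →L[ℝ] EuclideanSpace ℂ (Fin 3)) (p q : Fin 3 → ℝ) :
    ∑ i, ∑ l, p i * q l * ((M (EuclideanSpace.single l (1:ℂ))) i).re =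
      (⟪(WithLp.toLp 2 fun i => ((p i : ℝ) : ℂ) : EuclideanSpace ℂ (Fin 3)), M (WithLp.toLp 2 fun i => ((q i : ℝ) : ℂ))⟫_ℂ).re := by
  rw [realVec_eq_sum q, map_sum, PiLp.inner_apply, Complex.re_sum]
  refine Finset.sum_congr rfl fun i _ => ?_
  simp only [map_smul, WithLp.ofLp_sum, Finset.sum_apply, WithLp.ofLp_smul, Pi.smul_apply]
  rw [show ⟪((p i : ℝ) : ℂ), ∑ l, (q l : ℝ) • (M (EuclideanSpace.single l (1:ℂ))) i⟫_ℂ =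
      starRingEnd ℂ ((p i : ℝ) : ℂ) * ∑ l, (q l : ℝ) • (M (EuclideanSpace.single l (1:ℂ))) i from (RCLike.inner_apply _ _).trans (mul_comm _ _)]
  rw [Complex.conj_ofReal, Finset.mul_sum, Complex.re_sum]
  refine Finset.sum_congr rfl fun l _ => ?_
  rw [Complex.real_smul, ← mul_assoc, show ((p i : ℝ) : ℂ) * ((q l : ℝ) : ℂ) = (((p i * q l : ℝ)) : ℂ) by push_cast; ring, Complex.re_ofReal_mul]

/-- `Σ_{i,l} pᵢ q_l A_{il} = Re⟪pC, cmat(A) qC⟫` for a real matrix `A`. [folklore] -/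
theorem re_inner_cmat_realVec (A : Matrix (Fin 3) (Fin 3) ℝ) (p q : Fin 3 → ℝ) :
    ∑ i, ∑ l, p i * q l * A i l =
      (⟪(WithLp.toLp 2 fun i => ((p i : ℝ) : ℂ) : EuclideanSpace ℂ (Fin 3)),
        Matrix.toEuclideanCLM (n := Fin 3) (𝕜 := ℂ) (A.map ((↑) : ℝ → ℂ)) (WithLp.toLp 2 fun i => ((q i : ℝ) : ℂ))⟫_ℂ).re := by
  rw [PiLp.inner_apply, Complex.re_sum]
  refine Finset.sum_congr rfl fun i _ => ?_
  rw [toEuclideanCLM_map_apply]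
  rw [show ⟪((p i : ℝ) : ℂ), ∑ l, ((A i l : ℝ) : ℂ) * ((q l : ℝ) : ℂ)⟫_ℂ = starRingEnd ℂ ((p i : ℝ) : ℂ) * ∑ l, ((A i l : ℝ) : ℂ) * ((q l : ℝ) : ℂ) from
    (RCLike.inner_apply _ _).trans (mul_comm _ _)]
  rw [Complex.conj_ofReal, Finset.mul_sum, Complex.re_sum]
  refine Finset.sum_congr rfl fun l _ => ?_
  rw [show ((p i : ℝ) : ℂ) * (((A i l : ℝ) : ℂ) * ((q l : ℝ) : ℂ)) = (((p i * q l * A i l : ℝ)) : ℂ) by push_cast; ring, Complex.ofReal_re]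

/-- **THE SLOT-PAIR KERNEL AS A PAIRING** (`ν > 0`, `W₁ = (cubatureWord.stretch MB).stretch (1/ν)`):
`tailKernel ν S p q j j' = (ν/4π²)·Re⟪pC, M_{jj'} qC⟫ − Re⟪pC, cmat(freshMat S j j') qC⟫`. [cite: ArmstrongVicol2025, §3] -/
theorem tailKernel_eq_re_inner {ν : ℝ} (hν : 0 < ν) (S : T4) (p q : Fin 3 → ℝ) (j j' : Fin 26) :
    tailKernel ν S p q j j' =
      ν / (4 * π ^ 2) * (⟪(WithLp.toLp 2 fun i => ((p i : ℝ) : ℂ) : EuclideanSpace ℂ (Fin 3)),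
        meanFeedback ((cubatureWord.stretch MB MB_pos).stretch (1 / ν) (one_div_pos.mpr hν)) (ν • S) 1 (R0 ν) j j'
          (WithLp.toLp 2 fun i => ((q i : ℝ) : ℂ))⟫_ℂ).re -
      (⟪(WithLp.toLp 2 fun i => ((p i : ℝ) : ℂ) : EuclideanSpace ℂ (Fin 3)),
        Matrix.toEuclideanCLM (n := Fin 3) (𝕜 := ℂ) ((freshMat S j j').map ((↑) : ℝ → ℂ)) (WithLp.toLp 2 fun i => ((q i : ℝ) : ℂ))⟫_ℂ).re := by
  rw [tailKernel_def, ← re_inner_apply_realVec, ← re_inner_cmat_realVec, Finset.mul_sum, ← Finset.sum_sub_distrib]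
  refine Finset.sum_congr rfl fun i _ => ?_
  rw [Finset.mul_sum, ← Finset.sum_sub_distrib]
  refine Finset.sum_congr rfl fun l _ => ?_
  rw [Mre_of_pos hν]
  ring

/-- `‖P_{mⱼ} pC‖ = √(PpSq j p)`. [cite: Temam1984, Ch. III §1.1] -/
theorem norm_transversalProj_realVec (j : Fin 26) (p : Fin 3 → ℝ) :
    ‖transversalProj (cubatureWord.phase j).m (WithLp.toLp 2 fun i => ((p i : ℝ) : ℂ) : EuclideanSpace ℂ (Fin 3))‖ = Real.sqrt (PpSq j p) := by
  rw [← Real.sqrt_sq (norm_nonneg _), norm_transversalProj_ofReal_sq]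
  rfl

/-! ## §2 The cubature response setting -/

/-- The entries of the 26 wave vectors are in `{0, ±1}`. [folklore] -/
theorem slots_m_entry (j : Fin 26) (i : Fin 3) : (slots j).m i = 0 ∨ (slots j).m i = 1 ∨ (slots j).m i = -1 := by
  revert j i; decide

/-- `mⱼ ∈ box (R0 ν)` for `0 < ν ≤ 1`. [cite: MajdaKramer1999, §2.2.1.3] -/
theorem mem_box_cubature {ν : ℝ} (hν : 0 < ν) (hν1 : ν ≤ 1) (j : Fin 26) : (cubatureWord.phase j).m ∈ box (R0 ν) := by
  have hR : 1 ≤ R0 ν := by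
    unfold R0
    have h1 : (1:ℝ) ≤ (1 / ν) ^ 3 := one_le_pow₀ (by rw [le_div_iff₀ hν]; linarith)
    exact Nat.one_le_iff_ne_zero.mpr (by
      intro h0
      have := Nat.ceil_eq_zero.mp h0
      linarith)
  rw [mem_box]
  refine ⟨fun i => ?_, (cubatureWord.phase j).m_ne⟩
  have hm : (cubatureWord.phase j).m = (slots j).m := rfl
  rw [hm]
  have hR' : (1:ℤ) ≤ (R0 ν : ℤ) := by exact_mod_cast hR
  rcases slots_m_entry j i with h | h | h <;> rw [h] <;> omega

/-- `−mⱼ ∈ box (R0 ν)` for `0 < ν ≤ 1`. [cite: MajdaKramer1999, §2.2.1.3] -/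
theorem neg_mem_box_cubature {ν : ℝ} (hν : 0 < ν) (hν1 : ν ≤ 1) (j : Fin 26) : -(cubatureWord.phase j).m ∈ box (R0 ν) :=
  neg_mem_box (mem_box_cubature hν hν1 j)

/-- The response used by `psiStar cubatureWord MB MB_pos ν S` is a periodic response (`NearIso S (10/11) (11/10)`, `ν > 0`). [cite: SandersVerhulstMurdock2007, Lemma 5.2.7] -/
theorem isPeriodicResponse_cubature {ν : ℝ} (hν : 0 < ν) {S : T4} (hS : Torus.NearIso S (10 / 11) (11 / 10)) (j : Fin 26) :
    IsPeriodicResponse ((cubatureWord.stretch MB MB_pos).stretch (1 / ν) (one_div_pos.mpr hν)) (ν • S) 1 (R0 ν) j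
      (response ((cubatureWord.stretch MB MB_pos).stretch (1 / ν) (one_div_pos.mpr hν)) (ν • S) 1 (R0 ν) j) :=
  isPeriodicResponse_response_psiStar cubatureWord MB MB_pos hν hS (by norm_num) j

/-- `8π‖α_{j'}‖ = 2/|m_{j'}|` for the doubly stretched cubature word. [cite: MeshalkinSinai1961, pp. 1700–1705] -/
theorem eight_pi_norm_slotAmp {ν : ℝ} (hν : 0 < ν) (j : Fin 26) :
    8 * π * ‖slotAmp ((cubatureWord.stretch MB MB_pos).stretch (1 / ν) (one_div_pos.mpr hν)) j‖ = 2 / ‖latticeVec (cubatureWord.phase j).m‖ := by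
  have h := two_pi_mul_norm_slotAmp ((cubatureWord.stretch MB MB_pos).stretch (1 / ν) (one_div_pos.mpr hν)) j
  have hm : 0 < ‖latticeVec (cubatureWord.phase j).m‖ := norm_m_pos j
  have e : 8 * π * ‖slotAmp ((cubatureWord.stretch MB MB_pos).stretch (1 / ν) (one_div_pos.mpr hν)) j‖ =
      4 * (2 * π * ‖slotAmp ((cubatureWord.stretch MB MB_pos).stretch (1 / ν) (one_div_pos.mpr hν)) j‖) := by ring
  rw [e, h]
  show 4 * (1 / (2 * ‖latticeVec (cubatureWord.phase j).m‖)) = 2 / ‖latticeVec (cubatureWord.phase j).m‖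
  field_simp
  norm_num

/-! ## §3 The ν-free arithmetic of the table -/

/-- **THE ν's CANCEL**: with `P₁ = 3720·MB/ν` (period of the doubly stretched word), `L¹ⱼ = MBτⱼ/ν`, `r = 4π²ν(10/11)`:
`(ν/4π²)·((1/P₁)·((1/(2|mⱼ|))·A·(2·(e^{−θmin}·((8π‖α_{j'}‖/r)·B)))·L¹ⱼ)) = gTail j j'·(A·B)`. [cite: ArmstrongVicol2025, §3] -/
theorem tail_arith {ν : ℝ} (hν : 0 < ν) (hν40 : ν ≤ 1 / 40) (j j' : Fin 26) (A B : ℝ) :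
    let W₁ := (cubatureWord.stretch MB MB_pos).stretch (1 / ν) (one_div_pos.mpr hν)
    ν / (4 * π ^ 2) * ((1 / W₁.period) * ((1 / (2 * ‖latticeVec (cubatureWord.phase j).m‖) * A *
        (2 * (Real.exp (-θmin) * (8 * π * ‖slotAmp W₁ j'‖ / min (1:ℝ) (4 * π ^ 2 * (ν * (10 / 11))) * B)))) * (W₁.phase j).τ)) =
      gTail j j' * (A * B) := by
  intro W₁
  have hP : W₁.period = MB * cubatureWord.period / ν := period_stretch_stretch cubatureWord MB_pos hν
  have hL : (W₁.phase j).τ = MB * (cubatureWord.phase j).τ / ν := tau_stretch_stretch cubatureWord MB_pos hν j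
  have hmin : min (1:ℝ) (4 * π ^ 2 * (ν * (10 / 11))) = 4 * π ^ 2 * (ν * (10 / 11)) := min_one_viscRate ⟨hν, hν40⟩
  have hα : 8 * π * ‖slotAmp W₁ j'‖ = 2 / ‖latticeVec (cubatureWord.phase j').m‖ := eight_pi_norm_slotAmp hν j'
  have e8 : 8 * π * ‖slotAmp W₁ j'‖ / min (1:ℝ) (4 * π ^ 2 * (ν * (10 / 11))) = (2 / ‖latticeVec (cubatureWord.phase j').m‖) / (4 * π ^ 2 * (ν * (10 / 11))) := by
    rw [hmin, hα]
  rw [e8, hP, hL, gTail_def, Bst, G0, period_cubatureWord]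
  have hν0 : ν ≠ 0 := hν.ne'
  have hM : MB ≠ 0 := MB_pos.ne'
  have hm : ‖latticeVec (cubatureWord.phase j).m‖ ≠ 0 := (norm_m_pos j).ne'
  have hm' : ‖latticeVec (cubatureWord.phase j').m‖ ≠ 0 := (norm_m_pos j').ne'
  have hπ : π ≠ 0 := Real.pi_pos.ne'
  field_simp
  ring

end Summit.AnomalousDissipation.AnomalousDissipation.Theorems.SolenoidalFractalHomogenisation.LagrangianStep.D1Tail

end
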